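import Literature.Analysis.FluidPDE.NSLerayHopfSereginTrace
import Literature.Analysis.FunctionSpaces.RieszRepresentationTestFields
import HarnessLib

/-!
# Discharge of `riesz_L3_of_testField_bound` (Riesz representation `L³ = (L^{3/2})*` on test fields)

Analysis/FluidPDE proof file (no new definitions, no new named facts). It **proves** the named
fact `Literature.Analysis.FluidPDE.riesz_L3_of_testField_bound` of
`NSLerayHopfSereginTrace.lean` — the Riesz representation theorem in `L^{3/2}(ℝ³; ℝ³)` for
functionals given on test fields (Fonseca–Leoni 2007, Thm. 2.37 with Thm. 2.78), one of the two
printed inputs of `kato_trace_memLp_three` (Lemarié-Rieusset 2016, proof of Thm. 15.5, p. 573) —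
as the specialisation `E = ℝ³` of the tree's
`Literature.Analysis.FunctionSpaces.exists_memLp_three_repr_of_testField_bound`
(`FunctionSpaces/RieszRepresentationTestFields.lean`: reduction to the Hilbert space `L²` by the
weight `(1 + |x|²)^{d+1}` and Hölder, Hahn–Banach + Riesz–Fréchet, and the duality bound
`memLp_three_of_forall_abs_integral_inner_le`). The only work here is the conversion of the
`ℝ≥0∞`-valued bound `ENNReal.ofReal |Λ φ| ≤ M ‖φ‖_{3/2}` of the fact into its real form (test
fields lie in every `L^p`, so `‖φ‖_{3/2} < ∞`).

## References

* I. Fonseca, G. Leoni, *Modern Methods in the Calculus of Variations: `L^p` Spaces*, Springer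
  (2007), Thm. 2.37, Thm. 2.78. Bib key `FonsecaLeoni2007`.
* P. G. Lemarié-Rieusset, *The Navier–Stokes Problem in the 21st Century* (2016),
  doi:10.1201/b19556, proof of Thm. 15.5, p. 573.
-/

noncomputable section

open MeasureTheory TopologicalSpace Set Function Filter Metric
open _root_.Topology
open scoped ENNReal NNReal RealInnerProductSpace

namespace Literature.Analysis.FluidPDE

/-- **Discharge of `riesz_L3_of_testField_bound`** (Fonseca–Leoni 2007, Thm. 2.37 "Riesz
representation theorem in `L^p`" for `p = 3/2`, `q = 3`, with Thm. 2.78, density of `C_c^∞` in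
`L^p`): a real functional on fields `ℝ³ → ℝ³` which is additive, real homogeneous and bounded by
`M ‖φ‖_{L^{3/2}}` on the test fields is `φ ↦ ∫ ⟪u₁, φ⟫` for some `u₁ ∈ L³(ℝ³; ℝ³)` with
`‖u₁‖₃ ≤ M` — the case `E = ℝ³` of
`Literature.Analysis.FunctionSpaces.exists_memLp_three_repr_of_testField_bound`.
[cite: FonsecaLeoni2007, Thm. 2.37 with Thm. 2.78] -/
theorem riesz_L3_of_testField_bound_holds : riesz_L3_of_testField_bound := by
  intro M Λ hadd hsmul hbd
  -- the bound in real form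
  have hbd' : ∀ f : EuclideanSpace ℝ (Fin 3) → EuclideanSpace ℝ (Fin 3),
      FunctionSpaces.IsTestFunctionOn (⊤ : Opens (EuclideanSpace ℝ (Fin 3))) f →
      |Λ f| ≤ (M : ℝ) * (eLpNorm f (3 / 2 : ℝ≥0∞) volume).toReal := by
    intro f hf
    have hfq : eLpNorm f (3 / 2 : ℝ≥0∞) volume ≠ ⊤ :=
      (hf.contDiff.continuous.memLp_of_hasCompactSupport (p := (3 / 2 : ℝ≥0∞))
        (μ := volume) hf.hasCompactSupport).eLpNorm_ne_top
    have hfin : (M : ℝ≥0∞) * eLpNorm f (3 / 2 : ℝ≥0∞) volume ≠ ⊤ :=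
      ENNReal.mul_ne_top ENNReal.coe_ne_top hfq
    calc |Λ f| = (ENNReal.ofReal |Λ f|).toReal := (ENNReal.toReal_ofReal (abs_nonneg _)).symm
      _ ≤ ((M : ℝ≥0∞) * eLpNorm f (3 / 2 : ℝ≥0∞) volume).toReal :=
          ENNReal.toReal_mono hfin (hbd f hf)
      _ = (M : ℝ) * (eLpNorm f (3 / 2 : ℝ≥0∞) volume).toReal := by
          rw [ENNReal.toReal_mul, ENNReal.coe_toReal]
  obtain ⟨u, hu, hule, hrepr⟩ :=
    FunctionSpaces.exists_memLp_three_repr_of_testField_bound Λ hadd hsmul M.coe_nonneg hbd'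
  refine ⟨u, hu, ?_, hrepr⟩
  rwa [ENNReal.ofReal_coe_nnreal] at hule

end Literature.Analysis.FluidPDE
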